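import Summits.ValiantsHypothesis.ValiantsHypothesis.Theorems.SuccinctLiftJointPD
import Summits.ValiantsHypothesis.ValiantsHypothesis.Theorems.SuccinctLiftCharTwoParity
import Literature.Computability.AlgebraicComplexity.DepthReductionProofs

/-!
# SuccinctLift — joint computation with homogeneous gate values (`JointPDH` toolkit)

Support file for wall D of `route-ValiantsHypothesis-SuccinctLift` (stmt-ValiantsHypothesis-23721,
census cell W34 «2-non-unit cut»): the bookkeeping behind the gate-by-gate conversion of
`SuccinctLiftSmlCircuit` (low product-depth set-multilinearisation over ANY field, Forbes CCC 2024).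
`JointPDH v δ s` says that ONE gate list with `≤ s` gates and total fan-in `≤ s`, all of whose gate
values are homogeneous, computes every member `v i` of a family at product depth `≤ δ i` through a
stable operand (the predicate `JointPD` of `SuccinctLiftJointPD` refined by a gate count and the
homogeneity clause that the homogeneous engine `DepthWindow.homLst_geom_solved` consumes).  The file
proves: read-off as a circuit (`toCircuit`), re-indexing (`reindex`), the input family
(`jointPDH_of_inputs`), and the two extension steps — append, for each new index, ONE sum gate
(`extend_sum`, same depth) or ONE product gate (`extend_prod`, depth `+ 1`) over already computed
members — plus the list lemmas evaluating operands after appending one gate.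

References: Burgisser2000 (Def. 2.1, Rem. 2.7: the circuit model); Forbes2024LowDepth (CCC 2024, Thm. 1).
-/

noncomputable section

open MvPolynomial

-- the summit and the problem share the name `ValiantsHypothesis` (D-0017 single-conjunct layout)
set_option linter.dupNamespace false

namespace Summit.ValiantsHypothesis.ValiantsHypothesis.Theorems.SuccinctLiftSmlCircuitKit

open Literature.Computability.AlgebraicComplexity ArithCircuit SuccinctLiftJointPD

universe u v w

/-! ### `JointPDH`: joint computation with gate count and homogeneous gate values -/

section Toolkit

variable {k : Type u} [CommSemiring k] {τ : Type v}

/-- `JointPDH v δ s`: ONE gate list with `≤ s` gates and total fan-in `≤ s`, all of whose gate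
values are homogeneous, off which every member `v i` is read by a stable operand of product depth
`≤ δ i` (the predicate `JointPD` of `SuccinctLiftJointPD` refined by the gate count and the
homogeneity clause needed by the homogeneous LST engine). [cite: Burgisser2000, Rem. 2.7] -/
def JointPDH {ι : Type w} (v : ι → MvPolynomial τ k) (δ : ι → ℕ) (s : ℕ) : Prop :=
  ∃ G : List (Gate k τ), G.length ≤ s ∧ (G.map Gate.fanIn).sum ≤ s ∧
    (∀ w ∈ gateValues G, ∃ e : ℕ, w.IsHomogeneous e) ∧
    ∀ i, ∃ o : Operand k τ, (∀ ws, o.eval (gateValues G ++ ws) = v i) ∧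
      ∀ ds, o.depthIn (gateWDepths prodWeight G ++ ds) ≤ δ i

/-- Read a member off as a circuit with homogeneous gate values, product depth `≤ δ i`, and at most
`s` gates and `s` wires. [cite: Burgisser2000, Rem. 2.7] -/
theorem JointPDH.toCircuit {ι : Type w} {v : ι → MvPolynomial τ k} {δ : ι → ℕ} {s : ℕ}
    (h : JointPDH v δ s) (i : ι) :
    ∃ P : ArithCircuit k τ, P.Computes (v i) ∧ (∀ w ∈ gateValues P.gates, ∃ e : ℕ, w.IsHomogeneous e) ∧
      P.productDepth ≤ δ i ∧ P.size ≤ s ∧ P.edgeSize ≤ s := by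
  obtain ⟨G, hlen, hs, hhom, hG⟩ := h
  obtain ⟨o, ho, hd⟩ := hG i
  refine ⟨⟨G, o⟩, ?_, hhom, ?_, hlen, hs⟩
  · have := ho []
    rwa [List.append_nil] at this
  · have := hd []
    rwa [List.append_nil] at this

/-- Re-indexing, weakening, and adjoining variables and constants. [cite: Burgisser2000, Rem. 2.7] -/
theorem JointPDH.reindex {ι : Type w} {ι' : Type*} {v : ι → MvPolynomial τ k} {δ : ι → ℕ}
    {s s' : ℕ} (h : JointPDH v δ s) (w' : ι' → MvPolynomial τ k) (δ' : ι' → ℕ) (hs : s ≤ s')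
    (hw : ∀ i', (∃ i, w' i' = v i ∧ δ i ≤ δ' i') ∨ (∃ x, w' i' = X x) ∨ ∃ c, w' i' = C c) :
    JointPDH w' δ' s' := by
  obtain ⟨G, hlen, hG, hhom, hmem⟩ := h
  refine ⟨G, hlen.trans hs, hG.trans hs, hhom, fun i' => ?_⟩
  rcases hw i' with ⟨i, hi, hδ⟩ | ⟨x, hx⟩ | ⟨c, hc⟩
  · obtain ⟨o, ho, hd⟩ := hmem i
    exact ⟨o, fun ws => by rw [ho ws, hi], fun ds => (hd ds).trans hδ⟩
  · exact ⟨Operand.var x, fun ws => by rw [hx]; rfl, fun ds => Nat.zero_le _⟩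
  · exact ⟨Operand.const c, fun ws => by rw [hc]; rfl, fun ds => Nat.zero_le _⟩

/-- Inputs are free. [cite: Burgisser2000, Rem. 2.7] -/
theorem jointPDH_of_inputs {ι : Type w} (w' : ι → MvPolynomial τ k) (δ : ι → ℕ) (s : ℕ)
    (hw : ∀ i, (∃ x, w' i = X x) ∨ ∃ c, w' i = C c) : JointPDH w' δ s := by
  refine ⟨[], Nat.zero_le _, by simp, fun w hw => by simp [gateValues] at hw, fun i => ?_⟩
  rcases hw i with ⟨x, hx⟩ | ⟨c, hc⟩
  · exact ⟨Operand.var x, fun ws => by rw [hx]; rfl, fun ds => Nat.zero_le _⟩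
  · exact ⟨Operand.const c, fun ws => by rw [hc]; rfl, fun ds => Nat.zero_le _⟩

/-- **One linear layer** with homogeneous new values: cost `|κ| (|J| + 1)`, depth `≤ D`.
[cite: Burgisser2000, Rem. 2.7] -/
theorem JointPDH.extend_sum {ι : Type w} {v : ι → MvPolynomial τ k} {δ : ι → ℕ} {s : ℕ}
    (h : JointPDH v δ s) {κ : Type*} [Fintype κ] {J : Type*} [Fintype J]
    (a : κ → J → k) (src : κ → J → ι) (D : ℕ) (hD : ∀ x j, δ (src x j) ≤ D)
    (hnew : ∀ x, ∃ e : ℕ, (∑ j, a x j • v (src x j)).IsHomogeneous e) :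
    JointPDH (Sum.elim v (fun x => ∑ j, a x j • v (src x j))) (Sum.elim δ (fun _ => D))
      (s + Fintype.card κ * (Fintype.card J + 1)) := by
  classical
  obtain ⟨G, hlen, hG, hhom, hmem⟩ := h
  choose o ho hd using hmem
  have ho0 : ∀ i, (o i).eval (gateValues G) = v i := fun i => by
    simpa using ho i []
  set eJ := (Fintype.equivFin J).symm with heJ
  let gateOf : κ → Gate k τ := fun x =>
    Gate.sum (List.ofFn fun j : Fin (Fintype.card J) => (a x (eJ j), o (src x (eJ j))))
  have hgval : ∀ x vals, (∀ i, (o i).eval vals = v i) →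
      (gateOf x).eval vals = ∑ j, a x j • v (src x j) := by
    intro x vals hv
    simp only [gateOf, Gate.eval, List.map_ofFn, List.sum_ofFn, Function.comp_def, hv]
    exact Equiv.sum_comp eJ (fun j => a x j • v (src x j))
  have hval : ∀ x ws, (gateOf x).eval (gateValues G ++ ws) = (gateOf x).eval (gateValues G) := by
    intro x ws
    rw [hgval x _ (fun i => ho i ws), hgval x _ ho0]
  have hdep : ∀ x ds, prodWeight (gateOf x) +
      (((gateOf x).args.map (Operand.depthIn (gateWDepths prodWeight G ++ ds))).foldr max 0) ≤ D := by
    intro x ds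
    simp only [gateOf, prodWeight_sum, zero_add, Gate.args, List.map_ofFn]
    refine DepthReduction.foldr_max_le fun y hy => ?_
    rw [List.mem_ofFn] at hy
    obtain ⟨j, rfl⟩ := hy
    exact (hd _ ds).trans (hD _ _)
  have hB := block_members G gateOf D hval hdep
  have hstable : ∀ g ∈ List.ofFn (gateOf ∘ (Fintype.equivFin κ).symm), ∀ ws,
      g.eval (gateValues G ++ ws) = g.eval (gateValues G) := by
    intro g hg ws
    rw [List.mem_ofFn] at hg
    obtain ⟨j, rfl⟩ := hg
    exact hval _ ws
  refine ⟨G ++ List.ofFn (gateOf ∘ (Fintype.equivFin κ).symm), ?_, ?_, ?_, ?_⟩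
  · rw [List.length_append, List.length_ofFn]
    nlinarith
  · rw [List.map_append, List.sum_append, List.map_ofFn, List.sum_ofFn]
    have : ∀ j : Fin (Fintype.card κ),
        (Gate.fanIn ∘ gateOf ∘ (Fintype.equivFin κ).symm) j = Fintype.card J := by
      intro j
      simp [gateOf, Gate.fanIn, Gate.args, List.length_ofFn]
    simp only [this, Finset.sum_const, Finset.card_univ, Fintype.card_fin, smul_eq_mul]
    nlinarith
  · intro w hw
    rw [gateValues_append_of_stable G _ hstable, List.mem_append] at hw
    rcases hw with hw | hw
    · exact hhom w hw
    · rw [List.map_ofFn, List.mem_ofFn] at hw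
      obtain ⟨j, rfl⟩ := hw
      simp only [Function.comp]
      rw [hgval _ _ ho0]
      exact hnew _
  · rintro (i | x)
    · refine ⟨o i, fun ws => ?_, fun ds => ?_⟩
      · rw [Sum.elim_inl, gateValues_append_of_stable G _ hstable, List.append_assoc, ho]
      · obtain ⟨Ds, hDs, -, -⟩ := gateWDepths_append_le prodWeight G
          (List.ofFn (gateOf ∘ (Fintype.equivFin κ).symm)) D (fun g hg ds => by
            rw [List.mem_ofFn] at hg
            obtain ⟨j, rfl⟩ := hg
            exact hdep _ ds)
        rw [Sum.elim_inl, hDs, List.append_assoc]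
        exact hd i _
    · refine ⟨Operand.gate (G.length + Fintype.equivFin κ x), fun ws => ?_, fun ds => ?_⟩
      · rw [(hB x).1 ws, Sum.elim_inr, hgval x _ ho0]
      · rw [Sum.elim_inr]
        exact (hB x).2 ds

/-- **One product layer** with homogeneous new values: cost `|κ| (|J| + 1)`, depth `≤ D + 1`.
[cite: Burgisser2000, Rem. 2.7] -/
theorem JointPDH.extend_prod {ι : Type w} {v : ι → MvPolynomial τ k} {δ : ι → ℕ} {s : ℕ}
    (h : JointPDH v δ s) {κ : Type*} [Fintype κ] {J : Type*} [Fintype J]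
    (src : κ → J → ι) (D : ℕ) (hD : ∀ x j, δ (src x j) ≤ D)
    (hnew : ∀ x, ∃ e : ℕ, (∏ j, v (src x j)).IsHomogeneous e) :
    JointPDH (Sum.elim v (fun x => ∏ j, v (src x j))) (Sum.elim δ (fun _ => D + 1))
      (s + Fintype.card κ * (Fintype.card J + 1)) := by
  classical
  obtain ⟨G, hlen, hG, hhom, hmem⟩ := h
  choose o ho hd using hmem
  have ho0 : ∀ i, (o i).eval (gateValues G) = v i := fun i => by
    simpa using ho i []
  set eJ := (Fintype.equivFin J).symm with heJ
  let gateOf : κ → Gate k τ := fun x =>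
    Gate.prod (List.ofFn fun j : Fin (Fintype.card J) => o (src x (eJ j)))
  have hgval : ∀ x vals, (∀ i, (o i).eval vals = v i) →
      (gateOf x).eval vals = ∏ j, v (src x j) := by
    intro x vals hv
    simp only [gateOf, Gate.eval, List.map_ofFn, List.prod_ofFn, Function.comp_def, hv]
    exact Equiv.prod_comp eJ (fun j => v (src x j))
  have hval : ∀ x ws, (gateOf x).eval (gateValues G ++ ws) = (gateOf x).eval (gateValues G) := by
    intro x ws
    rw [hgval x _ (fun i => ho i ws), hgval x _ ho0]
  have hdep : ∀ x ds, prodWeight (gateOf x) +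
      (((gateOf x).args.map (Operand.depthIn (gateWDepths prodWeight G ++ ds))).foldr max 0) ≤ D + 1 := by
    intro x ds
    simp only [gateOf, prodWeight_prod, Gate.args, List.map_ofFn]
    rw [add_comm, Nat.add_le_add_iff_right]
    refine DepthReduction.foldr_max_le fun y hy => ?_
    rw [List.mem_ofFn] at hy
    obtain ⟨j, rfl⟩ := hy
    exact (hd _ ds).trans (hD _ _)
  have hB := block_members G gateOf (D + 1) hval hdep
  have hstable : ∀ g ∈ List.ofFn (gateOf ∘ (Fintype.equivFin κ).symm), ∀ ws,
      g.eval (gateValues G ++ ws) = g.eval (gateValues G) := by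
    intro g hg ws
    rw [List.mem_ofFn] at hg
    obtain ⟨j, rfl⟩ := hg
    exact hval _ ws
  refine ⟨G ++ List.ofFn (gateOf ∘ (Fintype.equivFin κ).symm), ?_, ?_, ?_, ?_⟩
  · rw [List.length_append, List.length_ofFn]
    nlinarith
  · rw [List.map_append, List.sum_append, List.map_ofFn, List.sum_ofFn]
    have : ∀ j : Fin (Fintype.card κ),
        (Gate.fanIn ∘ gateOf ∘ (Fintype.equivFin κ).symm) j = Fintype.card J := by
      intro j
      simp [gateOf, Gate.fanIn, Gate.args, List.length_ofFn]
    simp only [this, Finset.sum_const, Finset.card_univ, Fintype.card_fin, smul_eq_mul]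
    nlinarith
  · intro w hw
    rw [gateValues_append_of_stable G _ hstable, List.mem_append] at hw
    rcases hw with hw | hw
    · exact hhom w hw
    · rw [List.map_ofFn, List.mem_ofFn] at hw
      obtain ⟨j, rfl⟩ := hw
      simp only [Function.comp]
      rw [hgval _ _ ho0]
      exact hnew _
  · rintro (i | x)
    · refine ⟨o i, fun ws => ?_, fun ds => ?_⟩
      · rw [Sum.elim_inl, gateValues_append_of_stable G _ hstable, List.append_assoc, ho]
      · obtain ⟨Ds, hDs, -, -⟩ := gateWDepths_append_le prodWeight G
          (List.ofFn (gateOf ∘ (Fintype.equivFin κ).symm)) (D + 1) (fun g hg ds => by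
            rw [List.mem_ofFn] at hg
            obtain ⟨j, rfl⟩ := hg
            exact hdep _ ds)
        rw [Sum.elim_inl, hDs, List.append_assoc]
        exact hd i _
    · refine ⟨Operand.gate (G.length + Fintype.equivFin κ x), fun ws => ?_, fun ds => ?_⟩
      · rw [(hB x).1 ws, Sum.elim_inr, hgval x _ ho0]
      · rw [Sum.elim_inr]
        exact (hB x).2 ds

/-! ### One-gate updates of value and depth lists -/

omit [CommSemiring k] in
/-- Appending one entry does not change `getD` at other positions. [folklore] -/
theorem getD_append_singleton_of_ne {α : Type*} (L : List α) (y dflt : α) {j : ℕ}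
    (hj : j ≠ L.length) : (L ++ [y]).getD j dflt = L.getD j dflt := by
  rw [List.getD_eq_getElem?_getD, List.getD_eq_getElem?_getD]
  rcases Nat.lt_or_gt_of_ne hj with h | h
  · rw [List.getElem?_append_left h]
  · rw [List.getElem?_eq_none (by simp; omega), List.getElem?_eq_none (by omega)]

/-- Operands other than the reference to the new gate keep their value. [cite: Burgisser2000, Def. 2.1] -/
theorem eval_append_singleton_of_ne (vals : List (MvPolynomial τ k)) (y : MvPolynomial τ k)
    (o : Operand k τ) (ho : o ≠ Operand.gate vals.length) : o.eval (vals ++ [y]) = o.eval vals := by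
  cases o with
  | var i => rfl
  | const c => rfl
  | gate j =>
    simp only [Operand.eval]
    exact getD_append_singleton_of_ne vals y 0 (fun h => ho (by rw [h]))

/-- The reference to the new gate evaluates to its value. [cite: Burgisser2000, Def. 2.1] -/
theorem eval_gate_append_singleton (vals : List (MvPolynomial τ k)) (y : MvPolynomial τ k) :
    (Operand.gate vals.length : Operand k τ).eval (vals ++ [y]) = y :=
  SuccinctLiftCharTwo.T2.getD_append_length' vals y 0

omit [CommSemiring k] in
/-- Operands other than the reference to the new gate keep their depth. [cite: LST2021, §2] -/
theorem depthIn_append_singleton_of_ne (ds : List ℕ) (y : ℕ) (o : Operand k τ)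
    (ho : o ≠ Operand.gate ds.length) : o.depthIn (ds ++ [y]) = o.depthIn ds := by
  cases o with
  | var i => rfl
  | const c => rfl
  | gate j =>
    simp only [Operand.depthIn]
    exact getD_append_singleton_of_ne ds y 0 (fun h => ho (by rw [h]))

omit [CommSemiring k] in
/-- The reference to the new gate has its depth. [cite: LST2021, §2] -/
theorem depthIn_gate_append_singleton (ds : List ℕ) (y : ℕ) :
    (Operand.gate ds.length : Operand k τ).depthIn (ds ++ [y]) = y :=
  SuccinctLiftCharTwo.T2.getD_append_length' ds y 0

/-- A sum gate's value as a `Fintype` sum over its operand positions. [cite: Burgisser2000, Def. 2.1] -/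
theorem eval_sum_eq_sum_univ (vals : List (MvPolynomial τ k)) (l : List (k × Operand k τ)) :
    (Gate.sum l).eval vals = ∑ j : Fin l.length, (l.get j).1 • (l.get j).2.eval vals := by
  rw [Gate.eval, Fin.sum_univ_def]
  conv_rhs => rw [show (fun j : Fin l.length => (l.get j).1 • (l.get j).2.eval vals) =
    (fun a : k × Operand k τ => a.1 • a.2.eval vals) ∘ l.get from rfl, ← List.map_map,
    List.map_get_finRange]

/-- A product gate's value as a `Fintype` product over its operand positions. [cite: Burgisser2000, Def. 2.1] -/
theorem eval_prod_eq_prod_univ (vals : List (MvPolynomial τ k)) (l : List (Operand k τ)) :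
    (Gate.prod l).eval vals = ∏ j : Fin l.length, (l.get j).eval vals := by
  rw [Gate.eval, Fin.prod_univ_def]
  conv_rhs => rw [show (fun j : Fin l.length => (l.get j).eval vals) =
    (fun u : Operand k τ => u.eval vals) ∘ l.get from rfl, ← List.map_map, List.map_get_finRange]

end Toolkit

end Summit.ValiantsHypothesis.ValiantsHypothesis.Theorems.SuccinctLiftSmlCircuitKit
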